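import Summits.QuantumFields.YangMills.Theorems.UnitScaleTiltProp7FrakGEq3152
import Summits.QuantumFields.YangMills.Theorems.UnitScaleTiltProp7FrakGfRNormOfSupLetters
import HarnessLib

/-!
# Route `UnitScaleTilt`, crux K1 «MinimiserStabilityRegPr» (stmt-QuantumFields-19200), EX row `norm_G` (S47 ✓p766895), NORM_G ROAD (★p1 g27 CHAIR WORDs №24∕№25∕№28) —
# **THE (𝔊-ASSEMBLY DOOR): N1's two letters (V)∕(∇) for `𝔊 = frakGT … (DeltaOneP T_J) U₀` FROM PER-WORD LETTERS, over N2's `𝔊 = PᴾG₁ − H₁Q_kG₁` (✓p768265 `frakGT_DeltaOneP_eq`)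
# and `Pᴾu = u − DG′ᴾR_S(D*u)` (✓`gaugeCorrP_apply`) — print's «one derivative applied to the right»: the third word costs the DIVERGENCE row of `G₁`, not `‖Pᴾ‖_{∞→∞}`**

Cell `ym3-torus` (HUMAN RULING D-0037; rung R3 = SU(2) YM₃ on T³ — NOT d = 4, NOT infinite volume, NOT a mass gap, NOT Clay).  Width seat `ym3-torus-px17` (gen 11).
THEOREMS ONLY (0 `def`, 0 `sorry`, default heartbeats); `--supports stmt-QuantumFields-19200 --as helper`; count-neutral.

WHY.  After N1 (cst-p1 ✓p768493 `Prop7FrakGfRNormOfSupLetters.norm_frakGfR_apply_le_of_route_letters`: `norm_G` ⟸ the VALUE letter `‖toL2⁻¹(𝔊(toL2 A)) b‖ ≤ M_V‖A‖` and the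
(115)-GRADIENT letter `‖∇_{U₀}(toL2⁻¹(𝔊(toL2 A)) ∘ bondEquiv⁻¹)‖ ≤ M_∇‖A‖`) and N2 (this seat, ✓p768265: `𝔊x = Pᴾ(G₁x) − H₁(Q_k(G₁x))` at the slot `Δ₁ = Pᴾ†(Δ^η + T_J)Pᴾ`), the EX row `norm_G`
is a sum of THREE bond fields per source `A`: `G₁x`, `−D(G′ᴾ(R_S(D*(G₁x))))`, `−H₁(Q_k(G₁x))` (`x = toL2 A`).  THIS FILE turns per-word sup letters into N1's two letters:
(V) ⟸ {(V1) value row of `G₁`, (Div1) divergence row of `G₁` (★p1 g27's ⧗FILE C shape, [Balaban1985BackgroundPropagators] (3.130)–(3.131) bootstrap; `T_J` via px19 ✓p768852), (c2) `‖DG′ᴾR_S‖_{∞→∞}`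
(px5's (c)-package, FILE C's `hc2` text), (Hv) the value half of the EX row `norm_H₁` in route currency, (Qrow) the sup row of `Q_k`};
(∇) ⟸ {(∇1) the (115)-gradient row of `G₁` (N5∕(OF-GRAD) class), (Hess3) ONE displayed letter — the (115)-gradient of the third word `D G′ᴾR_S D*G₁A` = print's STOREY H ((3.43)₂∕(3.44), the
Schauder-grade class ★p1 WORD №28 item 7 recommends to DISPLAY), (H∇) the gradient half of `norm_H₁`, (Qrow), (V1)}.  §4 derives (Hv)∕(H∇) FROM THE EX ROW SHAPE `‖H1f … U₀ B‖ ≤ B_H‖B‖` itself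
(✓`H1f_apply`, ✓`norm_space115_eq`), so at the S-event `norm_G ⟸ norm_H₁ ∧ {G₁ rows} ∧ (c2) ∧ (Qrow) ∧ STOREY-H letter` — `norm_H₁` being ALREADY a displayed row of EX.

WHAT IS PROVED (ns `Summit.QuantumFields.YangMills.Theorems.Prop7FrakGSupRowsOfWords`; member `F`, `h : n ≤ K`, weights `c₀ cB`, coupling `0 ≤ a`, any `T_J` letter `TJ` (the display's is
`TJSlotP`: `DeltaOnePJ = DeltaOneP TJSlotP`), background `U₀` ON THE CLASS `hp : PosOnto … a (DeltaOneP … TJ) U₀`; `G₁ := GT … (DeltaOneP TJ) U₀`, `H₁ := HT … (DeltaOneP TJ) U₀`).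
* §1 `symm_frakGT_toL2_apply` — the bondwise three-term split of `toL2⁻¹(𝔊(toL2 A)) b`; `symm_frakGT_toL2_comp_eq` — the same as functions on lit bonds (for `∇`).
* §2 ★★★ `value_row_frakGT_of_words` — (V): `‖toL2⁻¹(𝔊(toL2 A)) b‖ ≤ (BV₁ + C₂·BD₁ + BH·BQ·BV₁)·‖A‖` from (V1)(Div1)(c2)(Hv)(Qrow).
* §3 ★★★ `gradient_row_frakGT_of_words` — (∇): `‖∇_{U₀}(toL2⁻¹(𝔊(toL2 A)) ∘ bondEquiv⁻¹)‖ ≤ (BG₁ + M₃ + BHG·BQ·BV₁)·‖A‖` from (∇1)(Hess3)(H∇)(Qrow)(V1) (`nabla115` is linear).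
* §4 ★★ `value_row_HT_of_normH1`, ★★ `gradient_row_HT_of_normH1` — (Hv)∕(H∇) with `BH = BHG := B_H` from the EX row text `∀ B, ‖H1f … (DeltaOneP TJ) U₀ B‖ ≤ B_H·‖B‖`.
* §5 ★★★ `norm_frakGfR_le_of_words` — E2E through N1's route door: `‖frakGfR … (DeltaOneP TJ) U₀ f‖ ≤ max M_V M_∇ · ‖f‖` from the word letters + the `norm_H₁` text.
HYP-SAT (★★OWNER RULING №42): `hp` ⟸ (γ) ✓p767766 at the J-slot (Π-road + the τ-row, CHAIR LOCATE №27); (V1)∕(Div1) ⟸ ★p1's FILE C at `DeltaOneP TJ` (⧗, `T_J` by ✓TJ-DIV); (∇1) ⟸ N5∕(OF-GRAD) class;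
(c2) ⟸ px5 (c)-package (✓ route editions announced 10:23Z); (Qrow) ⟸ px13 ✓ROW-3 `norm_QTwS_sub_lineIter_le_of_sup` class (`η·L^{K−n} = 1`); `norm_H₁` = a DISPLAYED EX row (class (1) socket of the S-event);
(Hess3) = STOREY H, to be DISPLAYED as a Thm-3.1 row per WORD №28 item 7.  All letters are linear sup rows; conclusions non-vacuous; no `Prop` placeholder.
CREDIT.  The VALUE half (§2) was typed CONCURRENTLY and independently by prover `ym-line-cst-p1` g36 (N1-V `…FrakGValueRowOfWordLetters`, SIGNATURE 544c4956, 2026-08-30T10:36Z),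
withdrawn unfiled in favour of this superset (bus 10:40:32Z); §4∕§5 stand on their N1 ✓p768493.
HONEST SCOPE.  Bookkeeping (triangle inequalities over a landed identity); no estimate; nothing of the word letters, `norm_G`, `norm_H₁`, the eight EX print rows, `hThm2S`, EX `stub_existenceMinimalOrbit`,
`MinimiserStabilityRegPr` (19200) or R3 is proved; the Yang–Mills mass gap is NOT proved.

References: T. Bałaban, CMP **102** (1985) 277–309 [Balaban1985Variational] ((103) p.293, (110)–(111) p.294, (115)–(117) pp.294–295); CMP **99** (1985) 389–434
[Balaban1985BackgroundPropagators] ((3.119) p.419, (3.126) p.420, (3.130)–(3.131) pp.421–422, Thm 3.1 (3.42)–(3.45) pp.397–398, (3.147) p.425, (3.152)–(3.153) p.426, Thm 3.13 p.426).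
-/

set_option autoImplicit false

noncomputable section

open scoped BigOperators Matrix.Norms.L2Operator InnerProductSpace ComplexConjugate

namespace Summit.QuantumFields.YangMills.Theorems.Prop7FrakGSupRowsOfWords

open Literature.MathematicalPhysics.QuantumFieldTheory.Balaban1983to89
open Literature.MathematicalPhysics.QuantumFieldTheory.Balaban1983to89.T3ContinuumYM3Torus
open B9SectCLatticeCarrier (Bond)
open B4Sect5Torus (TSite)
open B9Eq311L2Pairing (WL2)
open B11Eq115Space (NegSize Space115 JetSup NegSup)
open B11Eq111FrakG (nabla115)
open B11Eq103H1Complex (SiteL2K BondL2K)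
open Summit.QuantumFields.YangMills.Theorems.Prop7SectET3Transport (periodsT3 siteEquiv bondEquiv bgOfCfg)
open Summit.QuantumFields.YangMills.Theorems.Prop7SectET3HilbertLetters (W₂ frobEquiv toL2 toL2S toL2B DL2 DstarL2 toL2_symm_apply)
open Summit.QuantumFields.YangMills.Theorems.Prop7SectET3GaugeProjector (RS)
open Summit.QuantumFields.YangMills.Theorems.Prop7SectET3CurvedPropagators (Qk PosOnto GT HT H1f frakGT frakGfR H1f_apply)
open Summit.QuantumFields.YangMills.Theorems.Prop7SectET3DeltaPiPInv (GprimeP gaugeCorrP gaugeCorrP_apply)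
open Summit.QuantumFields.YangMills.Theorems.Prop7SectET3DeltaOnePInv (DeltaOneP)
open Summit.QuantumFields.YangMills.Theorems.Prop7FrakGEq3152 (frakGT_DeltaOneP_eq)
open Summit.QuantumFields.YangMills.Theorems.Prop7FrakGfRNormOfSupLetters (norm_space115_eq norm_frakGfR_apply_le_of_route_letters)

variable (F : T3Family) (n K : ℕ) (h : n ≤ K) (c₀ cB a : ℝ) [Fact (0 < c₀)] [Fact (0 < cB)]
  (TJ : GaugeField (F.P K) 0 (Matrix.specialUnitaryGroup (Fin 2) ℂ) → (BondL2K ℂ 3 (periodsT3 F K) c₀ W₂ →ₗ[ℂ] BondL2K ℂ 3 (periodsT3 F K) c₀ W₂))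
  (U₀ : GaugeField (F.P K) 0 (Matrix.specialUnitaryGroup (Fin 2) ℂ))

/-! ## §1 The three-term split of `toL2⁻¹(𝔊(toL2 A))` -/

/-- **`toL2⁻¹(𝔊(toL2 A)) b = toL2⁻¹(G₁x) b − toL2⁻¹(D(G′ᴾ(R_S(D*(G₁x))))) b − toL2⁻¹(H₁(Q_k(G₁x))) b`**, `x = toL2 A`, on the class (N2 ✓`frakGT_DeltaOneP_eq` + ✓`gaugeCorrP_apply`).
[cite: Balaban1985BackgroundPropagators, (3.119) p.419, (3.147) p.425, (3.152)–(3.153) p.426] -/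
theorem symm_frakGT_toL2_apply (ha : 0 ≤ a) (hp : PosOnto F n K h c₀ cB a (DeltaOneP F n K h c₀ cB a TJ) U₀)
    (A : PBond (F.P K) 0 → Matrix (Fin 2) (Fin 2) ℂ) (b : PBond (F.P K) 0) :
    (toL2 F K c₀).symm (frakGT F n K h c₀ cB a (DeltaOneP F n K h c₀ cB a TJ) U₀ (toL2 F K c₀ A)) b =
      (toL2 F K c₀).symm (GT F n K h c₀ cB a (DeltaOneP F n K h c₀ cB a TJ) U₀ (toL2 F K c₀ A)) b
        - (toL2 F K c₀).symm (DL2 F n K c₀ U₀ (GprimeP F n K h c₀ cB a U₀ (RS F n K h c₀ cB U₀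
            (DstarL2 F n K c₀ U₀ (GT F n K h c₀ cB a (DeltaOneP F n K h c₀ cB a TJ) U₀ (toL2 F K c₀ A)))))) b
        - (toL2 F K c₀).symm (HT F n K h c₀ cB a (DeltaOneP F n K h c₀ cB a TJ) U₀
            (Qk F n K h c₀ cB U₀ (GT F n K h c₀ cB a (DeltaOneP F n K h c₀ cB a TJ) U₀ (toL2 F K c₀ A)))) b := by
  rw [frakGT_DeltaOneP_eq TJ ha hp, gaugeCorrP_apply, map_sub, map_sub, Pi.sub_apply, Pi.sub_apply]

/-- The same split AS FUNCTIONS ON LIT BONDS (the argument of `∇_{U₀} = nabla115 …`). [cite: Balaban1985Variational, (115)–(117) pp.294–295] -/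
theorem symm_frakGT_toL2_comp_eq (ha : 0 ≤ a) (hp : PosOnto F n K h c₀ cB a (DeltaOneP F n K h c₀ cB a TJ) U₀)
    (A : PBond (F.P K) 0 → Matrix (Fin 2) (Fin 2) ℂ) :
    (fun q : Bond 3 (periodsT3 F K) =>
        (toL2 F K c₀).symm (frakGT F n K h c₀ cB a (DeltaOneP F n K h c₀ cB a TJ) U₀ (toL2 F K c₀ A)) ((bondEquiv F K).symm q)) =
      (fun q : Bond 3 (periodsT3 F K) =>
          (toL2 F K c₀).symm (GT F n K h c₀ cB a (DeltaOneP F n K h c₀ cB a TJ) U₀ (toL2 F K c₀ A)) ((bondEquiv F K).symm q))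
        - (fun q : Bond 3 (periodsT3 F K) =>
          (toL2 F K c₀).symm (DL2 F n K c₀ U₀ (GprimeP F n K h c₀ cB a U₀ (RS F n K h c₀ cB U₀
            (DstarL2 F n K c₀ U₀ (GT F n K h c₀ cB a (DeltaOneP F n K h c₀ cB a TJ) U₀ (toL2 F K c₀ A)))))) ((bondEquiv F K).symm q))
        - (fun q : Bond 3 (periodsT3 F K) =>
          (toL2 F K c₀).symm (HT F n K h c₀ cB a (DeltaOneP F n K h c₀ cB a TJ) U₀
            (Qk F n K h c₀ cB U₀ (GT F n K h c₀ cB a (DeltaOneP F n K h c₀ cB a TJ) U₀ (toL2 F K c₀ A)))) ((bondEquiv F K).symm q)) := by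
  funext q
  simp only [Pi.sub_apply]
  exact symm_frakGT_toL2_apply F n K h c₀ cB a TJ U₀ ha hp A _

/-! ## §2 The VALUE letter of `𝔊` from the word letters -/

/-- ★★★ **(V) FOR `𝔊` FROM THE WORDS**: with the value row (V1) `‖toL2⁻¹(G₁(toL2 A)) b‖ ≤ BV₁‖A‖`, the divergence row (Div1) `‖toL2S⁻¹(D*(G₁(toL2 A))) x‖ ≤ BD₁‖A‖`, the gradient-of-potential row
(c2) `‖DG′ᴾR_S‖_{∞→∞} ≤ C₂` (FILE C's `hc2` text), the value row (Hv) of `H₁` and the sup row (Qrow) of `Q_k`: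
`‖toL2⁻¹(𝔊(toL2 A)) b‖ ≤ (BV₁ + C₂·BD₁ + BH·BQ·BV₁)·‖A‖` — the third word pays the DIVERGENCE of `G₁` («one derivative applied to the right»), the second pays `H₁ × Q_k × G₁`.
[cite: Balaban1985BackgroundPropagators, (3.130)–(3.131) pp.421–422, (3.147) p.425, (3.152)–(3.153) p.426; Balaban1985Variational, (103) p.293, (117) p.295] -/
theorem value_row_frakGT_of_words (ha : 0 ≤ a) (hp : PosOnto F n K h c₀ cB a (DeltaOneP F n K h c₀ cB a TJ) U₀)
    {BV₁ BD₁ C₂ BH BQ : ℝ} (hBV₁ : 0 ≤ BV₁) (hBH : 0 ≤ BH) (hBQ : 0 ≤ BQ)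
    (hV1 : ∀ (A : PBond (F.P K) 0 → Matrix (Fin 2) (Fin 2) ℂ) (b : PBond (F.P K) 0),
      ‖(toL2 F K c₀).symm (GT F n K h c₀ cB a (DeltaOneP F n K h c₀ cB a TJ) U₀ (toL2 F K c₀ A)) b‖ ≤ BV₁ * ‖A‖)
    (hD1 : ∀ (A : PBond (F.P K) 0 → Matrix (Fin 2) (Fin 2) ℂ) (x : Site (F.P K) 0),
      ‖(toL2S F K c₀).symm (DstarL2 F n K c₀ U₀ (GT F n K h c₀ cB a (DeltaOneP F n K h c₀ cB a TJ) U₀ (toL2 F K c₀ A))) x‖ ≤ BD₁ * ‖A‖)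
    (hc2 : ∀ (v : Site (F.P K) 0 → Matrix (Fin 2) (Fin 2) ℂ) (m : ℝ), (∀ x, ‖v x‖ ≤ m) →
      ∀ b, ‖(toL2 F K c₀).symm (DL2 F n K c₀ U₀ (GprimeP F n K h c₀ cB a U₀ (RS F n K h c₀ cB U₀ (toL2S F K c₀ v)))) b‖ ≤ C₂ * m)
    (hH : ∀ (Y : PBond (F.P n) 0 → Matrix (Fin 2) (Fin 2) ℂ) (b : PBond (F.P K) 0),
      ‖(toL2 F K c₀).symm (HT F n K h c₀ cB a (DeltaOneP F n K h c₀ cB a TJ) U₀ (toL2B F n cB Y)) b‖ ≤ BH * ‖Y‖)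
    (hQ : ∀ (u : BondL2K ℂ 3 (periodsT3 F K) c₀ W₂) (s : ℝ), (∀ b, ‖(toL2 F K c₀).symm u b‖ ≤ s) →
      ∀ c, ‖(toL2B F n cB).symm (Qk F n K h c₀ cB U₀ u) c‖ ≤ BQ * s)
    (A : PBond (F.P K) 0 → Matrix (Fin 2) (Fin 2) ℂ) (b : PBond (F.P K) 0) :
    ‖(toL2 F K c₀).symm (frakGT F n K h c₀ cB a (DeltaOneP F n K h c₀ cB a TJ) U₀ (toL2 F K c₀ A)) b‖ ≤ (BV₁ + C₂ * BD₁ + BH * BQ * BV₁) * ‖A‖ := by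
  set x : BondL2K ℂ 3 (periodsT3 F K) c₀ W₂ := toL2 F K c₀ A with hxdef
  set u : BondL2K ℂ 3 (periodsT3 F K) c₀ W₂ := GT F n K h c₀ cB a (DeltaOneP F n K h c₀ cB a TJ) U₀ x with hudef
  -- word 1: the value row of `G₁`
  have h1 : ‖(toL2 F K c₀).symm u b‖ ≤ BV₁ * ‖A‖ := hV1 A b
  -- word 3: `D G′ᴾ R_S (D* u)` through (c2) at `v := toL2S⁻¹(D* u)` and (Div1)
  have h3 : ‖(toL2 F K c₀).symm (DL2 F n K c₀ U₀ (GprimeP F n K h c₀ cB a U₀ (RS F n K h c₀ cB U₀ (DstarL2 F n K c₀ U₀ u)))) b‖ ≤ C₂ * (BD₁ * ‖A‖) := by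
    have hv := hc2 ((toL2S F K c₀).symm (DstarL2 F n K c₀ U₀ u)) (BD₁ * ‖A‖) (fun y => hD1 A y) b
    rwa [LinearEquiv.apply_symm_apply] at hv
  -- word 2: `H₁(Q_k u)` through (Hv) at `Y := toL2B⁻¹(Q_k u)` and (Qrow)(V1)
  have hY : ‖(toL2B F n cB).symm (Qk F n K h c₀ cB U₀ u)‖ ≤ BQ * (BV₁ * ‖A‖) :=
    (pi_norm_le_iff_of_nonneg (by positivity)).2 (hQ u (BV₁ * ‖A‖) (fun b' => hV1 A b'))
  have h2 : ‖(toL2 F K c₀).symm (HT F n K h c₀ cB a (DeltaOneP F n K h c₀ cB a TJ) U₀ (Qk F n K h c₀ cB U₀ u)) b‖ ≤ BH * (BQ * (BV₁ * ‖A‖)) := by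
    have hw := hH ((toL2B F n cB).symm (Qk F n K h c₀ cB U₀ u)) b
    rw [LinearEquiv.apply_symm_apply] at hw
    exact hw.trans (mul_le_mul_of_nonneg_left hY hBH)
  rw [symm_frakGT_toL2_apply F n K h c₀ cB a TJ U₀ ha hp A b]
  calc ‖(toL2 F K c₀).symm u b
          - (toL2 F K c₀).symm (DL2 F n K c₀ U₀ (GprimeP F n K h c₀ cB a U₀ (RS F n K h c₀ cB U₀ (DstarL2 F n K c₀ U₀ u)))) b
          - (toL2 F K c₀).symm (HT F n K h c₀ cB a (DeltaOneP F n K h c₀ cB a TJ) U₀ (Qk F n K h c₀ cB U₀ u)) b‖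
        ≤ ‖(toL2 F K c₀).symm u b‖
          + ‖(toL2 F K c₀).symm (DL2 F n K c₀ U₀ (GprimeP F n K h c₀ cB a U₀ (RS F n K h c₀ cB U₀ (DstarL2 F n K c₀ U₀ u)))) b‖
          + ‖(toL2 F K c₀).symm (HT F n K h c₀ cB a (DeltaOneP F n K h c₀ cB a TJ) U₀ (Qk F n K h c₀ cB U₀ u)) b‖ := (norm_sub_le _ _).trans (add_le_add (norm_sub_le _ _) le_rfl)
    _ ≤ BV₁ * ‖A‖ + C₂ * (BD₁ * ‖A‖) + BH * (BQ * (BV₁ * ‖A‖)) := add_le_add (add_le_add h1 h3) h2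
    _ = (BV₁ + C₂ * BD₁ + BH * BQ * BV₁) * ‖A‖ := by ring

/-! ## §3 The (115)-GRADIENT letter of `𝔊` from the word letters -/

/-- ★★★ **(∇) FOR `𝔊` FROM THE WORDS**: with the (115)-gradient row (∇1) of `G₁`, ONE displayed letter (Hess3) for the (115)-gradient of the third word `D G′ᴾR_S D* G₁ A` (print's STOREY H),
the gradient row (H∇) of `H₁`, and (Qrow)(V1): `‖∇_{U₀}(toL2⁻¹(𝔊(toL2 A)) ∘ bondEquiv⁻¹)‖ ≤ (BG₁ + M₃ + BHG·BQ·BV₁)·‖A‖` (`nabla115` is linear).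
[cite: Balaban1985BackgroundPropagators, Thm 3.1 (3.42)–(3.45) pp.397–398, (3.152)–(3.153) p.426; Balaban1985Variational, (103) p.293, (115)–(117) pp.294–295] -/
theorem gradient_row_frakGT_of_words (ha : 0 ≤ a) (hp : PosOnto F n K h c₀ cB a (DeltaOneP F n K h c₀ cB a TJ) U₀)
    {BV₁ BG₁ M₃ BHG BQ : ℝ} (hBV₁ : 0 ≤ BV₁) (hBHG : 0 ≤ BHG) (hBQ : 0 ≤ BQ)
    (hV1 : ∀ (A : PBond (F.P K) 0 → Matrix (Fin 2) (Fin 2) ℂ) (b : PBond (F.P K) 0),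
      ‖(toL2 F K c₀).symm (GT F n K h c₀ cB a (DeltaOneP F n K h c₀ cB a TJ) U₀ (toL2 F K c₀ A)) b‖ ≤ BV₁ * ‖A‖)
    (hG1 : ∀ A : PBond (F.P K) 0 → Matrix (Fin 2) (Fin 2) ℂ,
      ‖nabla115 (((F.L : ℝ)⁻¹) ^ (K - n)) (bgOfCfg F K U₀)
          (fun q : Bond 3 (periodsT3 F K) => (toL2 F K c₀).symm (GT F n K h c₀ cB a (DeltaOneP F n K h c₀ cB a TJ) U₀ (toL2 F K c₀ A)) ((bondEquiv F K).symm q))‖ ≤ BG₁ * ‖A‖)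
    (h3 : ∀ A : PBond (F.P K) 0 → Matrix (Fin 2) (Fin 2) ℂ,
      ‖nabla115 (((F.L : ℝ)⁻¹) ^ (K - n)) (bgOfCfg F K U₀)
          (fun q : Bond 3 (periodsT3 F K) => (toL2 F K c₀).symm (DL2 F n K c₀ U₀ (GprimeP F n K h c₀ cB a U₀ (RS F n K h c₀ cB U₀
            (DstarL2 F n K c₀ U₀ (GT F n K h c₀ cB a (DeltaOneP F n K h c₀ cB a TJ) U₀ (toL2 F K c₀ A)))))) ((bondEquiv F K).symm q))‖ ≤ M₃ * ‖A‖)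
    (hHG : ∀ Y : PBond (F.P n) 0 → Matrix (Fin 2) (Fin 2) ℂ,
      ‖nabla115 (((F.L : ℝ)⁻¹) ^ (K - n)) (bgOfCfg F K U₀)
          (fun q : Bond 3 (periodsT3 F K) => (toL2 F K c₀).symm (HT F n K h c₀ cB a (DeltaOneP F n K h c₀ cB a TJ) U₀ (toL2B F n cB Y)) ((bondEquiv F K).symm q))‖ ≤ BHG * ‖Y‖)
    (hQ : ∀ (u : BondL2K ℂ 3 (periodsT3 F K) c₀ W₂) (s : ℝ), (∀ b, ‖(toL2 F K c₀).symm u b‖ ≤ s) →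
      ∀ c, ‖(toL2B F n cB).symm (Qk F n K h c₀ cB U₀ u) c‖ ≤ BQ * s)
    (A : PBond (F.P K) 0 → Matrix (Fin 2) (Fin 2) ℂ) :
    ‖nabla115 (((F.L : ℝ)⁻¹) ^ (K - n)) (bgOfCfg F K U₀)
        (fun q : Bond 3 (periodsT3 F K) =>
          (toL2 F K c₀).symm (frakGT F n K h c₀ cB a (DeltaOneP F n K h c₀ cB a TJ) U₀ (toL2 F K c₀ A)) ((bondEquiv F K).symm q))‖
      ≤ (BG₁ + M₃ + BHG * BQ * BV₁) * ‖A‖ := by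
  set x : BondL2K ℂ 3 (periodsT3 F K) c₀ W₂ := toL2 F K c₀ A with hxdef
  set u : BondL2K ℂ 3 (periodsT3 F K) c₀ W₂ := GT F n K h c₀ cB a (DeltaOneP F n K h c₀ cB a TJ) U₀ x with hudef
  -- word 2's coarse source and its size
  have hY : ‖(toL2B F n cB).symm (Qk F n K h c₀ cB U₀ u)‖ ≤ BQ * (BV₁ * ‖A‖) :=
    (pi_norm_le_iff_of_nonneg (by positivity)).2 (hQ u (BV₁ * ‖A‖) (fun b' => hV1 A b'))
  have h2 : ‖nabla115 (((F.L : ℝ)⁻¹) ^ (K - n)) (bgOfCfg F K U₀)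
      (fun q : Bond 3 (periodsT3 F K) => (toL2 F K c₀).symm (HT F n K h c₀ cB a (DeltaOneP F n K h c₀ cB a TJ) U₀ (Qk F n K h c₀ cB U₀ u)) ((bondEquiv F K).symm q))‖
        ≤ BHG * (BQ * (BV₁ * ‖A‖)) := by
    have hw := hHG ((toL2B F n cB).symm (Qk F n K h c₀ cB U₀ u))
    rw [LinearEquiv.apply_symm_apply] at hw
    exact hw.trans (mul_le_mul_of_nonneg_left hY hBHG)
  rw [symm_frakGT_toL2_comp_eq F n K h c₀ cB a TJ U₀ ha hp A, map_sub, map_sub]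
  calc ‖nabla115 (((F.L : ℝ)⁻¹) ^ (K - n)) (bgOfCfg F K U₀)
            (fun q : Bond 3 (periodsT3 F K) => (toL2 F K c₀).symm u ((bondEquiv F K).symm q))
          - nabla115 (((F.L : ℝ)⁻¹) ^ (K - n)) (bgOfCfg F K U₀)
            (fun q : Bond 3 (periodsT3 F K) => (toL2 F K c₀).symm (DL2 F n K c₀ U₀ (GprimeP F n K h c₀ cB a U₀ (RS F n K h c₀ cB U₀
              (DstarL2 F n K c₀ U₀ u)))) ((bondEquiv F K).symm q))
          - nabla115 (((F.L : ℝ)⁻¹) ^ (K - n)) (bgOfCfg F K U₀)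
            (fun q : Bond 3 (periodsT3 F K) => (toL2 F K c₀).symm (HT F n K h c₀ cB a (DeltaOneP F n K h c₀ cB a TJ) U₀ (Qk F n K h c₀ cB U₀ u)) ((bondEquiv F K).symm q))‖
        ≤ ‖nabla115 (((F.L : ℝ)⁻¹) ^ (K - n)) (bgOfCfg F K U₀)
            (fun q : Bond 3 (periodsT3 F K) => (toL2 F K c₀).symm u ((bondEquiv F K).symm q))‖
          + ‖nabla115 (((F.L : ℝ)⁻¹) ^ (K - n)) (bgOfCfg F K U₀)
            (fun q : Bond 3 (periodsT3 F K) => (toL2 F K c₀).symm (DL2 F n K c₀ U₀ (GprimeP F n K h c₀ cB a U₀ (RS F n K h c₀ cB U₀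
              (DstarL2 F n K c₀ U₀ u)))) ((bondEquiv F K).symm q))‖
          + ‖nabla115 (((F.L : ℝ)⁻¹) ^ (K - n)) (bgOfCfg F K U₀)
            (fun q : Bond 3 (periodsT3 F K) => (toL2 F K c₀).symm (HT F n K h c₀ cB a (DeltaOneP F n K h c₀ cB a TJ) U₀ (Qk F n K h c₀ cB U₀ u)) ((bondEquiv F K).symm q))‖ :=
          (norm_sub_le _ _).trans (add_le_add (norm_sub_le _ _) le_rfl)
    _ ≤ BG₁ * ‖A‖ + M₃ * ‖A‖ + BHG * (BQ * (BV₁ * ‖A‖)) := add_le_add (add_le_add (hG1 A) (h3 A)) h2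
    _ = (BG₁ + M₃ + BHG * BQ * BV₁) * ‖A‖ := by ring

/-! ## §4 The `H₁` letters from the EX row text `norm_H₁` -/

section H1Letters

variable [Fact (0 < (F.L : ℝ))] [Fact (0 < ((F.L : ℝ)⁻¹) ^ (K - n))]

/-- ★★ **(Hv) FROM `norm_H₁`'s TEXT**: `‖H1f … U₀ B‖ ≤ B_H‖B‖` for all coarse `B` (the EX row, (115)-norm) gives the route VALUE row `‖toL2⁻¹(H₁(toL2B Y)) b‖ ≤ B_H‖Y‖`
(✓`H1f_apply`, ✓`toL2_symm_apply`, ✓`norm_space115_eq`: the value half of the `max`). [cite: Balaban1985Variational, (103) p.293, (115) p.294] -/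
theorem value_row_HT_of_normH1 {BH : ℝ}
    (hnormH : ∀ B : PBond (F.P n) 0 → Matrix (Fin 2) (Fin 2) ℂ, ‖H1f F n K h c₀ cB a (DeltaOneP F n K h c₀ cB a TJ) U₀ B‖ ≤ BH * ‖B‖)
    (Y : PBond (F.P n) 0 → Matrix (Fin 2) (Fin 2) ℂ) (b : PBond (F.P K) 0) :
    ‖(toL2 F K c₀).symm (HT F n K h c₀ cB a (DeltaOneP F n K h c₀ cB a TJ) U₀ (toL2B F n cB Y)) b‖ ≤ BH * ‖Y‖ := by
  have hread : (toL2 F K c₀).symm (HT F n K h c₀ cB a (DeltaOneP F n K h c₀ cB a TJ) U₀ (toL2B F n cB Y)) b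
      = JetSup.equiv _ _ _ (H1f F n K h c₀ cB a (DeltaOneP F n K h c₀ cB a TJ) U₀ Y) (bondEquiv F K b) := by
    rw [toL2_symm_apply, H1f_apply]
  rw [hread]
  refine (norm_le_pi_norm _ _).trans ?_
  have hmax := norm_space115_eq F n K (nabla115 (((F.L : ℝ)⁻¹) ^ (K - n)) (bgOfCfg F K U₀)) (H1f F n K h c₀ cB a (DeltaOneP F n K h c₀ cB a TJ) U₀ Y)
  exact ((le_max_left _ _).trans_eq hmax.symm).trans (hnormH Y)

/-- ★★ **(H∇) FROM `norm_H₁`'s TEXT**: the route (115)-GRADIENT row `‖∇_{U₀}(toL2⁻¹(H₁(toL2B Y)) ∘ bondEquiv⁻¹)‖ ≤ B_H‖Y‖` (the gradient half of the `max`; the function IS `JetSup.equiv (H1f … Y)`).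
[cite: Balaban1985Variational, (103) p.293, (115) p.294] -/
theorem gradient_row_HT_of_normH1 {BH : ℝ}
    (hnormH : ∀ B : PBond (F.P n) 0 → Matrix (Fin 2) (Fin 2) ℂ, ‖H1f F n K h c₀ cB a (DeltaOneP F n K h c₀ cB a TJ) U₀ B‖ ≤ BH * ‖B‖)
    (Y : PBond (F.P n) 0 → Matrix (Fin 2) (Fin 2) ℂ) :
    ‖nabla115 (((F.L : ℝ)⁻¹) ^ (K - n)) (bgOfCfg F K U₀)
        (fun q : Bond 3 (periodsT3 F K) => (toL2 F K c₀).symm (HT F n K h c₀ cB a (DeltaOneP F n K h c₀ cB a TJ) U₀ (toL2B F n cB Y)) ((bondEquiv F K).symm q))‖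
      ≤ BH * ‖Y‖ := by
  have hread : (fun q : Bond 3 (periodsT3 F K) => (toL2 F K c₀).symm (HT F n K h c₀ cB a (DeltaOneP F n K h c₀ cB a TJ) U₀ (toL2B F n cB Y)) ((bondEquiv F K).symm q))
      = JetSup.equiv _ _ _ (H1f F n K h c₀ cB a (DeltaOneP F n K h c₀ cB a TJ) U₀ Y) := by
    funext q
    rw [toL2_symm_apply, Equiv.apply_symm_apply, H1f_apply]
  rw [hread]
  have hmax := norm_space115_eq F n K (nabla115 (((F.L : ℝ)⁻¹) ^ (K - n)) (bgOfCfg F K U₀)) (H1f F n K h c₀ cB a (DeltaOneP F n K h c₀ cB a TJ) U₀ Y)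
  exact ((le_max_right _ _).trans_eq hmax.symm).trans (hnormH Y)

/-! ## §5 End to end through N1's route door -/

/-- ★★★ **`norm_G`'s INEQUALITY AT THE SLOT `Δ₁ = Pᴾ†(Δ^η + T_J)Pᴾ` FROM THE WORD LETTERS AND THE `norm_H₁` TEXT**: `‖frakGfR … (DeltaOneP T_J) U₀ f‖ ≤ max M_V M_∇ · ‖f‖` with
`M_V = BV₁ + C₂·BD₁ + B_H·BQ·BV₁`, `M_∇ = BG₁ + M₃ + B_H·BQ·BV₁` (N1 ✓`norm_frakGfR_apply_le_of_route_letters` ∘ §2 ∘ §3 ∘ §4).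
[cite: Balaban1985Variational, (117) p.295; Balaban1985BackgroundPropagators, Thm 3.13 p.426, (3.130)–(3.131) pp.421–422, (3.152)–(3.153) p.426] -/
theorem norm_frakGfR_le_of_words (ha : 0 ≤ a) (hp : PosOnto F n K h c₀ cB a (DeltaOneP F n K h c₀ cB a TJ) U₀)
    {BV₁ BD₁ C₂ BH BQ BG₁ M₃ : ℝ} (hBV₁ : 0 ≤ BV₁) (hBD₁ : 0 ≤ BD₁) (hC₂ : 0 ≤ C₂) (hBH : 0 ≤ BH) (hBQ : 0 ≤ BQ)
    (hV1 : ∀ (A : PBond (F.P K) 0 → Matrix (Fin 2) (Fin 2) ℂ) (b : PBond (F.P K) 0),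
      ‖(toL2 F K c₀).symm (GT F n K h c₀ cB a (DeltaOneP F n K h c₀ cB a TJ) U₀ (toL2 F K c₀ A)) b‖ ≤ BV₁ * ‖A‖)
    (hD1 : ∀ (A : PBond (F.P K) 0 → Matrix (Fin 2) (Fin 2) ℂ) (x : Site (F.P K) 0),
      ‖(toL2S F K c₀).symm (DstarL2 F n K c₀ U₀ (GT F n K h c₀ cB a (DeltaOneP F n K h c₀ cB a TJ) U₀ (toL2 F K c₀ A))) x‖ ≤ BD₁ * ‖A‖)
    (hc2 : ∀ (v : Site (F.P K) 0 → Matrix (Fin 2) (Fin 2) ℂ) (m : ℝ), (∀ x, ‖v x‖ ≤ m) →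
      ∀ b, ‖(toL2 F K c₀).symm (DL2 F n K c₀ U₀ (GprimeP F n K h c₀ cB a U₀ (RS F n K h c₀ cB U₀ (toL2S F K c₀ v)))) b‖ ≤ C₂ * m)
    (hQ : ∀ (u : BondL2K ℂ 3 (periodsT3 F K) c₀ W₂) (s : ℝ), (∀ b, ‖(toL2 F K c₀).symm u b‖ ≤ s) →
      ∀ c, ‖(toL2B F n cB).symm (Qk F n K h c₀ cB U₀ u) c‖ ≤ BQ * s)
    (hG1 : ∀ A : PBond (F.P K) 0 → Matrix (Fin 2) (Fin 2) ℂ,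
      ‖nabla115 (((F.L : ℝ)⁻¹) ^ (K - n)) (bgOfCfg F K U₀)
          (fun q : Bond 3 (periodsT3 F K) => (toL2 F K c₀).symm (GT F n K h c₀ cB a (DeltaOneP F n K h c₀ cB a TJ) U₀ (toL2 F K c₀ A)) ((bondEquiv F K).symm q))‖ ≤ BG₁ * ‖A‖)
    (h3 : ∀ A : PBond (F.P K) 0 → Matrix (Fin 2) (Fin 2) ℂ,
      ‖nabla115 (((F.L : ℝ)⁻¹) ^ (K - n)) (bgOfCfg F K U₀)
          (fun q : Bond 3 (periodsT3 F K) => (toL2 F K c₀).symm (DL2 F n K c₀ U₀ (GprimeP F n K h c₀ cB a U₀ (RS F n K h c₀ cB U₀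
            (DstarL2 F n K c₀ U₀ (GT F n K h c₀ cB a (DeltaOneP F n K h c₀ cB a TJ) U₀ (toL2 F K c₀ A)))))) ((bondEquiv F K).symm q))‖ ≤ M₃ * ‖A‖)
    (hnormH : ∀ B : PBond (F.P n) 0 → Matrix (Fin 2) (Fin 2) ℂ, ‖H1f F n K h c₀ cB a (DeltaOneP F n K h c₀ cB a TJ) U₀ B‖ ≤ BH * ‖B‖)
    (f : NegSize (F.L : ℝ) (((F.L : ℝ)⁻¹) ^ (K - n)) (fun _ : Bond 3 (periodsT3 F K) => K - n) 3 (Matrix (Fin 2) (Fin 2) ℂ)) :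
    ‖frakGfR F n K h c₀ cB a (DeltaOneP F n K h c₀ cB a TJ) U₀ f‖ ≤ max (BV₁ + C₂ * BD₁ + BH * BQ * BV₁) (BG₁ + M₃ + BH * BQ * BV₁) * ‖f‖ :=
  norm_frakGfR_apply_le_of_route_letters F n K h c₀ cB a (DeltaOneP F n K h c₀ cB a TJ) U₀ (by positivity)
    (fun A b => value_row_frakGT_of_words F n K h c₀ cB a TJ U₀ ha hp hBV₁ hBH hBQ hV1 hD1 hc2
      (fun Y b' => value_row_HT_of_normH1 F n K h c₀ cB a TJ U₀ hnormH Y b') hQ A b)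
    (fun A => gradient_row_frakGT_of_words F n K h c₀ cB a TJ U₀ ha hp hBV₁ hBH hBQ hV1 hG1 h3
      (fun Y => gradient_row_HT_of_normH1 F n K h c₀ cB a TJ U₀ hnormH Y) hQ A) f

end H1Letters

end Summit.QuantumFields.YangMills.Theorems.Prop7FrakGSupRowsOfWords

end
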